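import Mathlib
import Summits.KontsevichZagierPeriods.Zeta5Search.Families.EdgePowers
import HarnessLib

/-!
# ζ(5) search — Families: Hepp-sector bounds for products of powers of point differences

HONEST FRAMING: systematic search; no irrationality claim unless certified.  This file contains NO statement about
zeta values.  It continues `Families/EdgePowers.lean` (ANALYTIC half of Brown's convergence criterion [Brown2016,
§2.4, Lemma 3.6, Def. 5.1], seat P2): for a permutation `π` of the `ℓ+1` gaps (rank `k ↦` gap `π k`, rank `0` =
smallest) and a gap vector sorted along `π` (`Sorted π g`), every edge has a TOP gap `E.top π i` (the gap of its span
of highest rank) and `g(top) ≤ len ≤ (ℓ+1)·g(top)`; hence the two-sided comparison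
`Klo · ∏_w g_w^{A_π(w)} ≤ powProd ≤ Kup · ∏_w g_w^{A_π(w)}` with the aggregated exponents
`A_π(w) = Σ_{i : top i = w} c_i` (`aggExp`, `aggMono`; `powProd_le_aggMono`, `aggMono_le_powProd`), and the
identification of the tail partial sums of the rank-ordered aggregated exponents with block functionals of the
low-rank gap sets (`psum_aggExp_eq_blockSum`), which feed the tail conditions of `Families/SectorIntegrals`.
Standard axioms only.
-/

noncomputable section

open MeasureTheory Set Finset

namespace Summit.KontsevichZagierPeriods.Zeta5Search.Families.Cellular

variable {ℓ : ℕ} {ι : Type*} (E : EdgeFamily ℓ ι)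

namespace EdgeFamily

/-! ### Hepp sectors: sorted gap vectors and top gaps -/

/-- The gap vector `g` is sorted along `π`: `g (π 0) ≤ g (π 1) ≤ ⋯` (rank `0` = smallest gap). -/
def Sorted (π : Equiv.Perm (Fin (ℓ + 1))) (g : Fin (ℓ + 1) → ℝ) : Prop := Monotone (g ∘ π)

/-- Every gap vector is sorted along some permutation. -/
theorem exists_sorted (g : Fin (ℓ + 1) → ℝ) : ∃ π : Equiv.Perm (Fin (ℓ + 1)), Sorted π g :=
  ⟨Tuple.sort g, Tuple.monotone_sort g⟩

variable (π : Equiv.Perm (Fin (ℓ + 1)))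

/-- The top gap of edge `i`: the gap of its span of highest rank along `π`. -/
def top (i : ι) : Fin (ℓ + 1) :=
  π (((E.span i).image π.symm).max' ((E.span_nonempty i).image _))

/-- The top gap lies in the span. -/
theorem top_mem_span (i : ι) : E.top π i ∈ E.span i := by
  unfold top
  obtain ⟨w, hw, hw'⟩ := Finset.mem_image.1 (Finset.max'_mem ((E.span i).image π.symm) ((E.span_nonempty i).image _))
  rw [← hw', Equiv.apply_symm_apply]
  exact hw

/-- Every gap of the span has rank at most the rank of the top gap. -/
theorem rank_le_rank_top {i : ι} {w : Fin (ℓ + 1)} (hw : w ∈ E.span i) : π.symm w ≤ π.symm (E.top π i) := by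
  unfold top
  rw [Equiv.symm_apply_apply]
  exact Finset.le_max' _ _ (Finset.mem_image_of_mem _ hw)

/-- On a sorted gap vector, every gap of the span is at most the top gap. -/
theorem gap_le_top {g : Fin (ℓ + 1) → ℝ} (hs : Sorted π g) {i : ι} {w : Fin (ℓ + 1)} (hw : w ∈ E.span i) :
    g w ≤ g (E.top π i) := by
  have := hs (E.rank_le_rank_top π hw)
  simpa using this

/-- Two-sided comparison of an edge length with its top gap (sorted positive gaps). -/
theorem top_le_len_le {t : Fin ℓ → ℝ} (ht : t ∈ openSimplex ℓ) (hs : Sorted π fun w => gapN t w) (i : ι) :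
    gapN t (E.top π i) ≤ E.len t i ∧ E.len t i ≤ (ℓ + 1) * gapN t (E.top π i) := by
  have hpos := (mem_openSimplex_iff_gapN t).1 ht
  rw [E.len_eq_sum_gap]
  constructor
  · exact Finset.single_le_sum (fun w _ => (hpos w).le) (E.top_mem_span π i)
  · calc ∑ w ∈ E.span i, gapN t w ≤ ∑ _w ∈ E.span i, gapN t (E.top π i) :=
          Finset.sum_le_sum fun w hw => E.gap_le_top π hs hw
      _ = (E.span i).card * gapN t (E.top π i) := by rw [Finset.sum_const, nsmul_eq_mul]
      _ ≤ (ℓ + 1) * gapN t (E.top π i) := by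
          gcongr
          · exact (hpos _).le
          · have := Finset.card_le_univ (E.span i)
            rw [Fintype.card_fin] at this
            exact_mod_cast this

/-! ### Aggregated exponents and the two-sided comparison -/

/-- The aggregated exponent of gap `w`: the sum of `c_i` over the edges whose top gap is `w`. -/
def aggExp [Fintype ι] (c : ι → ℝ) (w : Fin (ℓ + 1)) : ℝ := ∑ i ∈ univ.filter (fun i => E.top π i = w), c i

/-- The sector monomial `∏_w g_w ^ A_π(w)`. -/
def aggMono [Fintype ι] (c : ι → ℝ) (g : Fin (ℓ + 1) → ℝ) : ℝ := ∏ w, g w ^ E.aggExp π c w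

/-- Regrouping: `∏_i g(top i)^{c_i} = ∏_w g_w^{A_π(w)}` for positive `g`. -/
theorem prod_top_eq_aggMono [Fintype ι] (c : ι → ℝ) {g : Fin (ℓ + 1) → ℝ} (hg : ∀ w, 0 < g w) :
    ∏ i, g (E.top π i) ^ c i = E.aggMono π c g := by
  classical
  unfold aggMono aggExp
  rw [← Finset.prod_fiberwise univ (E.top π) fun i => g (E.top π i) ^ c i]
  refine Finset.prod_congr rfl fun w _ => ?_
  rw [Real.rpow_sum_of_pos (hg w)]
  refine Finset.prod_congr rfl fun i hi => ?_
  rw [(Finset.mem_filter.1 hi).2]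

/-- Upper constant. -/
def Kup [Fintype ι] (ℓ : ℕ) (c : ι → ℝ) : ℝ := ∏ i, max 1 ((ℓ + 1 : ℝ) ^ c i)

/-- Lower constant. -/
def Klo [Fintype ι] (ℓ : ℕ) (c : ι → ℝ) : ℝ := ∏ i, min 1 ((ℓ + 1 : ℝ) ^ c i)

/-- `Klo > 0`. -/
theorem Klo_pos [Fintype ι] (c : ι → ℝ) : 0 < Klo ℓ c :=
  Finset.prod_pos fun i _ => lt_min one_pos (Real.rpow_pos_of_pos (by positivity) _)

/-- One factor: `min(1,(ℓ+1)^c)·m^c ≤ d^c ≤ max(1,(ℓ+1)^c)·m^c` whenever `0 < m ≤ d ≤ (ℓ+1) m`. -/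
theorem rpow_two_sided {m d : ℝ} (hm : 0 < m) (hmd : m ≤ d) (hdm : d ≤ (ℓ + 1) * m) (c : ℝ) :
    min 1 ((ℓ + 1 : ℝ) ^ c) * m ^ c ≤ d ^ c ∧ d ^ c ≤ max 1 ((ℓ + 1 : ℝ) ^ c) * m ^ c := by
  have hL : (0 : ℝ) < ℓ + 1 := by positivity
  have hmc : 0 ≤ m ^ c := Real.rpow_nonneg hm.le _
  have hprod : ((ℓ + 1 : ℝ) * m) ^ c = (ℓ + 1 : ℝ) ^ c * m ^ c := Real.mul_rpow hL.le hm.le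
  rcases le_or_gt 0 c with hc | hc
  · constructor
    · calc min 1 ((ℓ + 1 : ℝ) ^ c) * m ^ c ≤ 1 * m ^ c := by gcongr; exact min_le_left _ _
        _ = m ^ c := one_mul _
        _ ≤ d ^ c := Real.rpow_le_rpow hm.le hmd hc
    · calc d ^ c ≤ ((ℓ + 1 : ℝ) * m) ^ c := Real.rpow_le_rpow (hm.le.trans hmd) hdm hc
        _ = (ℓ + 1 : ℝ) ^ c * m ^ c := hprod
        _ ≤ max 1 ((ℓ + 1 : ℝ) ^ c) * m ^ c := by gcongr; exact le_max_right _ _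
  · constructor
    · calc min 1 ((ℓ + 1 : ℝ) ^ c) * m ^ c ≤ (ℓ + 1 : ℝ) ^ c * m ^ c := by gcongr; exact min_le_right _ _
        _ = ((ℓ + 1 : ℝ) * m) ^ c := hprod.symm
        _ ≤ d ^ c := Real.rpow_le_rpow_of_nonpos (hm.trans_le hmd) hdm hc.le
    · calc d ^ c ≤ m ^ c := Real.rpow_le_rpow_of_nonpos hm hmd hc.le
        _ = 1 * m ^ c := (one_mul _).symm
        _ ≤ max 1 ((ℓ + 1 : ℝ) ^ c) * m ^ c := by gcongr; exact le_max_left _ _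

/-- **Upper comparison** on a Hepp sector: `powProd ≤ Kup · aggMono`. -/
theorem powProd_le_aggMono [Fintype ι] (c : ι → ℝ) {t : Fin ℓ → ℝ} (ht : t ∈ openSimplex ℓ)
    (hs : Sorted π fun w => gapN t w) :
    E.powProd c t ≤ Kup ℓ c * E.aggMono π c (fun w => gapN t w) := by
  have hpos := (mem_openSimplex_iff_gapN t).1 ht
  rw [← E.prod_top_eq_aggMono π c hpos, Kup, ← Finset.prod_mul_distrib]
  unfold powProd
  refine Finset.prod_le_prod (fun i _ => Real.rpow_nonneg (E.len_pos ht i).le _) fun i _ => ?_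
  have h := E.top_le_len_le π ht hs i
  exact (rpow_two_sided (hpos _) h.1 h.2 (c i)).2

/-- **Lower comparison** on a Hepp sector: `Klo · aggMono ≤ powProd`. -/
theorem aggMono_le_powProd [Fintype ι] (c : ι → ℝ) {t : Fin ℓ → ℝ} (ht : t ∈ openSimplex ℓ)
    (hs : Sorted π fun w => gapN t w) :
    Klo ℓ c * E.aggMono π c (fun w => gapN t w) ≤ E.powProd c t := by
  have hpos := (mem_openSimplex_iff_gapN t).1 ht
  rw [← E.prod_top_eq_aggMono π c hpos, Klo, ← Finset.prod_mul_distrib]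
  unfold powProd
  refine Finset.prod_le_prod (fun i _ => mul_nonneg (lt_min one_pos (Real.rpow_pos_of_pos (by positivity) _)).le
    (Real.rpow_nonneg (hpos _).le _)) fun i _ => ?_
  have h := E.top_le_len_le π ht hs i
  exact (rpow_two_sided (hpos _) h.1 h.2 (c i)).1

/-! ### Aggregated exponents over a final segment of ranks = block functional -/

/-- The gaps of the `j+1` lowest ranks. -/
def lowGaps (j : Fin (ℓ + 1)) : Finset (Fin (ℓ + 1)) := univ.filter fun w => π.symm w ≤ j

/-- `lowGaps π j` has `j + 1` elements. -/
theorem card_lowGaps (j : Fin (ℓ + 1)) : (lowGaps π j).card = j + 1 := by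
  unfold lowGaps
  have : (univ.filter fun w : Fin (ℓ + 1) => π.symm w ≤ j) = (Finset.Iic j).map π.toEmbedding := by
    ext w
    simp only [Finset.mem_filter, Finset.mem_univ, true_and, Finset.mem_map, Finset.mem_Iic,
      Equiv.toEmbedding_apply]
    constructor
    · intro h; exact ⟨π.symm w, h, π.apply_symm_apply w⟩
    · rintro ⟨k, hk, rfl⟩; simpa using hk
  rw [this, Finset.card_map, Fin.card_Iic]

/-- An edge has its top gap among the `j+1` lowest-ranked gaps iff its whole span is. -/
theorem top_mem_lowGaps_iff (j : Fin (ℓ + 1)) (i : ι) : π.symm (E.top π i) ≤ j ↔ E.span i ⊆ lowGaps π j := by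
  constructor
  · intro h w hw
    unfold lowGaps
    rw [Finset.mem_filter]
    exact ⟨Finset.mem_univ _, (E.rank_le_rank_top π hw).trans h⟩
  · intro h
    have := h (E.top_mem_span π i)
    unfold lowGaps at this
    exact (Finset.mem_filter.1 this).2

/-- Partial sums of the rank-ordered aggregated exponents are block functionals of the low gap sets:
`(j+1) + Σ_{k ≤ j} A_π(π k) = blockSum (lowGaps π j)`. -/
theorem psum_aggExp_eq_blockSum [Fintype ι] (c : ι → ℝ) (j : Fin (ℓ + 1)) :
    ((j : ℝ) + 1) + ∑ k : Fin (ℓ + 1), (if k ≤ j then E.aggExp π c (π k) else 0) =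
      E.blockSum c (lowGaps π j) := by
  classical
  unfold blockSum
  rw [card_lowGaps]
  push_cast
  congr 1
  rw [← Finset.sum_filter]
  unfold aggExp
  rw [Finset.sum_sigma' (univ.filter fun k : Fin (ℓ + 1) => k ≤ j) (fun k => univ.filter fun i => E.top π i = π k)
    (fun k i => c i)]
  symm
  refine Finset.sum_nbij' (fun i => ⟨π.symm (E.top π i), i⟩) (fun ki => ki.2) ?_ ?_ ?_ ?_ ?_
  · intro i hi
    simp only [Finset.mem_filter, Finset.mem_univ, true_and] at hi
    simp only [Finset.mem_sigma, Finset.mem_filter, Finset.mem_univ, true_and, Equiv.apply_symm_apply, and_true]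
    exact (E.top_mem_lowGaps_iff π j i).2 hi
  · rintro ⟨k, i⟩ hki
    simp only [Finset.mem_sigma, Finset.mem_filter, Finset.mem_univ, true_and] at hki
    simp only [Finset.mem_filter, Finset.mem_univ, true_and]
    rw [← E.top_mem_lowGaps_iff π j i, hki.2, Equiv.symm_apply_apply]
    exact hki.1
  · intro i _; rfl
  · rintro ⟨k, i⟩ hki
    simp only [Finset.mem_sigma, Finset.mem_filter, Finset.mem_univ, true_and] at hki
    simp [hki.2]
  · intro i _; rfl

end EdgeFamily

end Summit.KontsevichZagierPeriods.Zeta5Search.Families.Cellular
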